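import Summits.AtomisticToContinuum.HydrodynamicLimit.Theorems.CollisionIsometryCLTMacroClosureStubLedgerScaling
import Literature.Analysis.FunctionSpaces.FlatTorusProofs

/-!
# The squeeze `SqueezeToBlockGibbs` (route JaynesSqueeze), II: the one-body intensity measure and its blocks

Helper file (`--supports stmt-AtomisticToContinuum-13463`) for the support item `SqueezeToBlockGibbs` of route
`JaynesSqueeze`. The items `NoMeanEntropyProduction`, `MeanBlocksInRange` and `BlockGibbs` of the route are
phrased through the ONE-BODY INTENSITY MEASURE of an `(N+1)`-particle law `Q` on phase space,
`μ_Q = (N+1)⁻¹ Σᵢ Q ∘ πᵢ⁻¹` on `𝕋³ × ℝ³`, its restrictions to the macroscopic cubes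
`B_k = {x | (⌊m · repr x i⌋₊)ᵢ = k}` of side `1/m`, and the block masses / mean velocities / kinetic temperatures
of those restrictions. This file records the elementary measure theory the squeeze needs:

* `integral_intensity_eq` — `∫ h dμ_Q = E_Q ⟨emp z, h⟩` (the log-density of a local Gibbs reference is a
  one-body sum, so its `Q`-mean is an integral against `μ_Q`); `integrable_intensity_of_forall`,
  `isProbabilityMeasure_intensity`;
* `integral_blockwise_eq_sum` — an integrand depending on `x` only through its block index decomposes over
  the `m³` blocks into integrals against the block velocity measures `((μ.restrict (B_k ×ˢ univ)).snd)`;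
* `log_localGibbsProfile_block`, `integral_blockLogProfile` — for BLOCK-CONSTANT parameters the log-profile is
  such an integrand, and its block integrals are `mass · (log ca + log (2π cθ)^{-3/2}) − (2cθ)⁻¹ ∫ |v − cu|²`;
* `volume_block`, `integral_comp_blockIdx` — each block has volume `m⁻³`, so `∫ g(idx x) dx = Σ_k m⁻³ g(k)`.

References: Yau 1991 §2 (one-body sums against local Gibbs references); Spohn 1991 Part I §2.3.
-/

noncomputable section

open MeasureTheory Filter Set Topology
open scoped ENNReal

namespace Summit.AtomisticToContinuum.HydrodynamicLimit.Theorems.JaynesSqueezeSqueeze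

open Literature.MathematicalPhysics.KineticTheory Literature.Analysis.FluidPDE
open Literature.Analysis.FunctionSpaces
open MacroClosureLine.StubLedger

/-! ## The intensity measure -/

/-- **Means of one-body sums are integrals against the intensity measure**: for a finite law `Q` of `N + 1`
particles and `h` with `h ∘ πᵢ` `Q`-integrable for every `i`,
`∫ h d((N+1)⁻¹ Σᵢ Q ∘ πᵢ⁻¹) = ∫ ⟨emp z, h⟩ dQ(z)`. [folklore] -/
theorem integral_intensity_eq {N : ℕ} (Q : Measure (Config (N + 1) (Fin 3) T3)) [IsFiniteMeasure Q]
    {h : T3 × V3 → ℝ} (hm : StronglyMeasurable h) (hint : ∀ i : Fin (N + 1), Integrable (fun z => h (z i)) Q) :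
    ∫ y, h y ∂(((N : ℝ≥0∞) + 1)⁻¹ • Measure.sum fun i : Fin (N + 1) => Q.map fun z => z i) =
      ∫ z, (∫ y, h y ∂(empiricalMeasure z)) ∂Q := by
  rw [integral_smul_measure, Measure.sum_fintype, integral_finsetSum_measure]
  · simp_rw [integral_empiricalMeasure]
    rw [integral_const_mul, integral_finsetSum _ fun i _ => hint i]
    congr 1
    · rw [ENNReal.toReal_inv]
      push_cast
      rw [ENNReal.toReal_add (by simp) (by simp)]
      simp
    · refine Finset.sum_congr rfl fun i _ => ?_
      exact integral_map (measurable_pi_apply i).aemeasurable hm.aestronglyMeasurable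
  · intro i _
    exact (integrable_map_measure hm.aestronglyMeasurable (measurable_pi_apply i).aemeasurable).2 (hint i)

/-- Lower-integral form (no integrability needed): `∫⁻ g dμ_Q = (N+1)⁻¹ Σᵢ ∫⁻ g(zᵢ) dQ`. [folklore] -/
theorem lintegral_intensity_eq {N : ℕ} (Q : Measure (Config (N + 1) (Fin 3) T3)) {g : T3 × V3 → ℝ≥0∞}
    (hg : Measurable g) :
    ∫⁻ y, g y ∂(((N : ℝ≥0∞) + 1)⁻¹ • Measure.sum fun i : Fin (N + 1) => Q.map fun z => z i) =
      ((N : ℝ≥0∞) + 1)⁻¹ * ∑ i : Fin (N + 1), ∫⁻ z, g (z i) ∂Q := by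
  rw [lintegral_smul_measure, Measure.sum_fintype, lintegral_finsetSum_measure]
  congr 1
  refine Finset.sum_congr rfl fun i _ => ?_
  exact lintegral_map hg (measurable_pi_apply i)

/-- The intensity measure of a probability law is a probability measure. [folklore] -/
theorem isProbabilityMeasure_intensity {N : ℕ} (Q : Measure (Config (N + 1) (Fin 3) T3))
    [IsProbabilityMeasure Q] :
    IsProbabilityMeasure (((N : ℝ≥0∞) + 1)⁻¹ • Measure.sum fun i : Fin (N + 1) => Q.map fun z => z i) := by
  refine ⟨?_⟩
  have h := lintegral_intensity_eq Q (g := fun _ => 1) measurable_const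
  simp only [lintegral_const, measure_univ, mul_one, one_mul, Finset.sum_const, Finset.card_univ,
    Fintype.card_fin, nsmul_eq_mul] at h
  rw [h]
  push_cast
  exact ENNReal.inv_mul_cancel (by simp) (by simp)

/-- Integrability against the intensity measure from integrability of each `h ∘ πᵢ`. [folklore] -/
theorem integrable_intensity_of_forall {N : ℕ} (Q : Measure (Config (N + 1) (Fin 3) T3))
    {h : T3 × V3 → ℝ} (hm : StronglyMeasurable h) (hint : ∀ i : Fin (N + 1), Integrable (fun z => h (z i)) Q) :
    Integrable h (((N : ℝ≥0∞) + 1)⁻¹ • Measure.sum fun i : Fin (N + 1) => Q.map fun z => z i) := by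
  refine Integrable.smul_measure ?_ (ENNReal.inv_ne_top.2 (by simp))
  rw [Measure.sum_fintype]
  refine integrable_finsetSum_measure.2 fun i _ => ?_
  exact (integrable_map_measure hm.aestronglyMeasurable (measurable_pi_apply i).aemeasurable).2 (hint i)

/-- Each single-particle kinetic energy is dominated by the total: if `⟨emp z, |v|²⟩` is `Q`-integrable then
so is `|vᵢ|²` for every `i`. [folklore] -/
theorem integrable_norm_sq_apply {N : ℕ} (Q : Measure (Config (N + 1) (Fin 3) T3))
    (hK : Integrable (fun z => ∫ y, ‖y.2‖ ^ 2 ∂(empiricalMeasure z)) Q) (i : Fin (N + 1)) :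
    Integrable (fun z : Config (N + 1) (Fin 3) T3 => ‖(z i).2‖ ^ 2) Q := by
  have hm : Measurable fun z : Config (N + 1) (Fin 3) T3 => ‖(z i).2‖ ^ 2 :=
    (measurable_pi_apply i).snd.norm.pow_const 2
  refine (hK.const_mul ((N : ℝ) + 1)).mono' hm.aestronglyMeasurable (ae_of_all _ fun z => ?_)
  rw [Real.norm_eq_abs, abs_of_nonneg (sq_nonneg _), kineticPair_eq_sum, ← mul_assoc,
    mul_inv_cancel₀ (by positivity), one_mul]
  exact Finset.single_le_sum (f := fun k => ‖(z k).2‖ ^ 2) (fun k _ => sq_nonneg _) (Finset.mem_univ i)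

/-- The velocity second moment of the intensity measure is the mean kinetic pairing:
`∫ |v|² dμ_Q = E_Q ⟨emp, |v|²⟩`, and `|v|²` is `μ_Q`-integrable. [folklore] -/
theorem integral_norm_sq_intensity {N : ℕ} (Q : Measure (Config (N + 1) (Fin 3) T3)) [IsFiniteMeasure Q]
    (hK : Integrable (fun z => ∫ y, ‖y.2‖ ^ 2 ∂(empiricalMeasure z)) Q) :
    Integrable (fun y : T3 × V3 => ‖y.2‖ ^ 2)
        (((N : ℝ≥0∞) + 1)⁻¹ • Measure.sum fun i : Fin (N + 1) => Q.map fun z => z i) ∧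
      ∫ y, ‖y.2‖ ^ 2 ∂(((N : ℝ≥0∞) + 1)⁻¹ • Measure.sum fun i : Fin (N + 1) => Q.map fun z => z i) =
        ∫ z, (∫ y, ‖y.2‖ ^ 2 ∂(empiricalMeasure z)) ∂Q := by
  have hm : StronglyMeasurable fun y : T3 × V3 => ‖y.2‖ ^ 2 :=
    (measurable_snd.norm.pow_const 2).stronglyMeasurable
  exact ⟨integrable_intensity_of_forall Q hm (integrable_norm_sq_apply Q hK),
    integral_intensity_eq Q hm (integrable_norm_sq_apply Q hK)⟩

/-! ## Blocks -/

/-- The block index is in range: `⌊m · repr x i⌋₊ < m` for `0 < m`. [folklore] -/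
theorem blockIdx_lt {m : ℕ} (hm : 0 < m) (x : T3) (i : Fin 3) : ⌊(m : ℝ) * Torus.repr x i⌋₊ < m := by
  have h := Torus.repr_apply_mem_Ico x i
  rw [Nat.floor_lt (mul_nonneg (Nat.cast_nonneg m) h.1)]
  calc (m : ℝ) * Torus.repr x i < m * 1 := mul_lt_mul_of_pos_left h.2 (Nat.cast_pos.2 hm)
    _ = m := mul_one _

/-- Every point lies in a block indexed by `range m ^ 3` (`0 < m`). [folklore] -/
theorem blockIdx_mem_piFinset {m : ℕ} (hm : 0 < m) (x : T3) :
    (fun i => ⌊(m : ℝ) * Torus.repr x i⌋₊) ∈ Fintype.piFinset fun _ : Fin 3 => Finset.range m := by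
  rw [Fintype.mem_piFinset]
  exact fun i => Finset.mem_range.2 (blockIdx_lt hm x i)

/-- The block index map is measurable. [folklore] -/
theorem measurable_blockIdx (m : ℕ) : Measurable fun x : T3 => fun i => ⌊(m : ℝ) * Torus.repr x i⌋₊ := by
  refine measurable_pi_lambda _ fun i => Nat.measurable_floor.comp (measurable_const.mul ?_)
  exact (measurable_pi_apply i).comp ((WithLp.measurable_ofLp 2 _).comp Torus.measurable_repr)

/-- Blocks are measurable. [folklore] -/
theorem measurableSet_block (m : ℕ) (k : Fin 3 → ℕ) :
    MeasurableSet {x : T3 | (fun i => ⌊(m : ℝ) * Torus.repr x i⌋₊) = k} :=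
  measurableSet_eq_fun (measurable_blockIdx m) measurable_const

/-- **Blockwise decomposition.** For a finite measure `μ` on `𝕋³ × ℝ³`, `0 < m`, and an integrable integrand that
depends on the position only through its block index, `∫ H(idx x, v) dμ = Σ_k ∫ H(k, v) d(μ|_{B_k × ℝ³})^{(v)}`,
the sum over `k ∈ range m ^ 3`. [folklore] -/
theorem integral_blockwise_eq_sum (μ : Measure (T3 × V3)) [IsFiniteMeasure μ] {m : ℕ} (hm : 0 < m)
    {H : (Fin 3 → ℕ) → V3 → ℝ} (hHm : ∀ k, StronglyMeasurable (H k))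
    (hH : Integrable (fun y : T3 × V3 => H (fun i => ⌊(m : ℝ) * Torus.repr y.1 i⌋₊) y.2) μ) :
    ∫ y, H (fun i => ⌊(m : ℝ) * Torus.repr y.1 i⌋₊) y.2 ∂μ =
      ∑ k ∈ Fintype.piFinset (fun _ : Fin 3 => Finset.range m),
        ∫ v, H k v ∂((μ.restrict ({x : T3 | (fun i => ⌊(m : ℝ) * Torus.repr x i⌋₊) = k} ×ˢ
          (univ : Set V3))).snd) := by
  set K := Fintype.piFinset (fun _ : Fin 3 => Finset.range m) with hK
  set S : (Fin 3 → ℕ) → Set (T3 × V3) := fun k =>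
    {x : T3 | (fun i => ⌊(m : ℝ) * Torus.repr x i⌋₊) = k} ×ˢ (univ : Set V3) with hS
  have hSm : ∀ k, MeasurableSet (S k) := fun k => (measurableSet_block m k).prod MeasurableSet.univ
  have hdisj : Set.Pairwise (↑K : Set (Fin 3 → ℕ)) (Function.onFun Disjoint S) := by
    intro k _ k' _ hkk'
    refine Set.disjoint_left.2 fun y hy hy' => hkk' ?_
    simp only [hS, mem_prod, mem_setOf_eq, mem_univ, and_true] at hy hy'
    rw [← hy, ← hy']
  have hcover : μ.restrict (⋃ k ∈ K, S k) = μ := by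
    rw [Measure.restrict_eq_self_of_ae_mem]
    refine ae_of_all _ fun y => ?_
    simp only [mem_iUnion, exists_prop]
    exact ⟨_, blockIdx_mem_piFinset hm y.1, by simp [hS]⟩
  conv_lhs => rw [← hcover]
  rw [integral_biUnion_finset K (fun k _ => hSm k) hdisj fun k _ => hH.integrableOn]
  refine Finset.sum_congr rfl fun k _ => ?_
  rw [Measure.snd, integral_map measurable_snd.aemeasurable (hHm k).aestronglyMeasurable]
  refine integral_congr_ae ?_
  filter_upwards [ae_restrict_mem (hSm k)] with y hy
  simp only [hS, mem_prod, mem_setOf_eq, mem_univ, and_true] at hy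
  rw [hy]

/-- The mass of a block velocity measure is the measure of the block. [folklore] -/
theorem blockVel_univ (μ : Measure (T3 × V3)) (m : ℕ) (k : Fin 3 → ℕ) :
    (μ.restrict ({x : T3 | (fun i => ⌊(m : ℝ) * Torus.repr x i⌋₊) = k} ×ˢ (univ : Set V3))).snd univ =
      μ ({x : T3 | (fun i => ⌊(m : ℝ) * Torus.repr x i⌋₊) = k} ×ˢ (univ : Set V3)) := by
  rw [Measure.snd_univ, Measure.restrict_apply_univ]

/-- Velocity moments of a block velocity measure are restricted moments of `μ`: for measurable `g ≥ 0`,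
`∫⁻ g d(μ|_{B_k×ℝ³})^{(v)} ≤ ∫⁻ g(v) dμ`. [folklore] -/
theorem lintegral_blockVel_le (μ : Measure (T3 × V3)) (m : ℕ) (k : Fin 3 → ℕ) {g : V3 → ℝ≥0∞}
    (hg : Measurable g) :
    ∫⁻ v, g v ∂((μ.restrict ({x : T3 | (fun i => ⌊(m : ℝ) * Torus.repr x i⌋₊) = k} ×ˢ
        (univ : Set V3))).snd) ≤ ∫⁻ y, g y.2 ∂μ := by
  rw [Measure.snd, lintegral_map hg measurable_snd]
  exact lintegral_mono' Measure.restrict_le_self le_rfl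

/-- The block velocity measures of a finite measure with finite velocity second moment are finite measures with
finite second moment: `|v|²` and `|v − c|²` are integrable. [folklore] -/
theorem integrable_norm_sub_sq_blockVel (μ : Measure (T3 × V3)) [IsFiniteMeasure μ]
    (h2 : Integrable (fun y : T3 × V3 => ‖y.2‖ ^ 2) μ) (m : ℕ) (k : Fin 3 → ℕ) (c : V3) :
    Integrable (fun v : V3 => ‖v - c‖ ^ 2)
      ((μ.restrict ({x : T3 | (fun i => ⌊(m : ℝ) * Torus.repr x i⌋₊) = k} ×ˢ (univ : Set V3))).snd) := by
  set ν := (μ.restrict ({x : T3 | (fun i => ⌊(m : ℝ) * Torus.repr x i⌋₊) = k} ×ˢ (univ : Set V3))).snd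
    with hν
  haveI : IsFiniteMeasure ν := by rw [hν]; infer_instance
  have hsq : Integrable (fun v : V3 => ‖v‖ ^ 2) ν := by
    rw [hν, Measure.snd]
    refine (integrable_map_measure (by fun_prop) measurable_snd.aemeasurable).2 ?_
    exact h2.restrict
  have hdom : Integrable (fun v : V3 => 2 * ‖v‖ ^ 2 + 2 * ‖c‖ ^ 2) ν := (hsq.const_mul 2).add (integrable_const _)
  refine hdom.mono' (by fun_prop) (ae_of_all _ fun v => ?_)
  rw [Real.norm_eq_abs, abs_of_nonneg (sq_nonneg _)]
  have h1 : ‖v - c‖ ^ 2 ≤ (‖v‖ + ‖c‖) ^ 2 := by gcongr; exact norm_sub_le v c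
  nlinarith [h1, sq_nonneg (‖v‖ - ‖c‖)]

/-! ## Block-constant local Gibbs profiles -/

/-- The log-profile of BLOCK-CONSTANT parameters depends on the position only through its block:
`log prof(x, v) = log ca_k + log (2π cθ_k)^{-3/2} − |v − cu_k|²/(2 cθ_k)`, `k = idx x`. [folklore] -/
theorem log_localGibbsProfile_block (m : ℕ) {ca cθ : (Fin 3 → ℕ) → ℝ} (cu : (Fin 3 → ℕ) → V3)
    (hca : ∀ k, 0 < ca k) (hcθ : ∀ k, 0 < cθ k) (x : T3) (v : V3) :
    Real.log (localGibbsProfile (fun x => ca (fun i => ⌊(m : ℝ) * Torus.repr x i⌋₊))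
        (fun x => cu (fun i => ⌊(m : ℝ) * Torus.repr x i⌋₊))
        (fun x => cθ (fun i => ⌊(m : ℝ) * Torus.repr x i⌋₊)) (x, v)) =
      Real.log (ca (fun i => ⌊(m : ℝ) * Torus.repr x i⌋₊)) +
        Real.log ((2 * Real.pi * cθ (fun i => ⌊(m : ℝ) * Torus.repr x i⌋₊)) ^ (-(Module.finrank ℝ V3 : ℝ) / 2)) -
        ‖v - cu (fun i => ⌊(m : ℝ) * Torus.repr x i⌋₊)‖ ^ 2 / (2 * cθ (fun i => ⌊(m : ℝ) * Torus.repr x i⌋₊)) :=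
  log_localGibbsProfile_eq x v (hca _) (hcθ _)

/-- **Block integrals of the log-profile.** For a finite measure `ν` on `ℝ³` with finite second moment and
constants `ca, cθ > 0`, `cu`:
`∫ (log ca + log (2π cθ)^{-3/2} − |v − cu|²/(2cθ)) dν = ν(ℝ³)(log ca + log (2π cθ)^{-3/2}) − (2cθ)⁻¹ ∫ |v − cu|² dν`.
[folklore] -/
theorem integral_blockLogProfile (ν : Measure V3) [IsFiniteMeasure ν] {ca cθ : ℝ} (cu : V3)
    (h2 : Integrable (fun v : V3 => ‖v - cu‖ ^ 2) ν) :
    ∫ v, (Real.log ca + Real.log ((2 * Real.pi * cθ) ^ (-(Module.finrank ℝ V3 : ℝ) / 2)) -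
        ‖v - cu‖ ^ 2 / (2 * cθ)) ∂ν =
      (ν univ).toReal * (Real.log ca + Real.log ((2 * Real.pi * cθ) ^ (-(Module.finrank ℝ V3 : ℝ) / 2))) -
        (2 * cθ)⁻¹ * ∫ v, ‖v - cu‖ ^ 2 ∂ν := by
  rw [integral_sub (integrable_const _) (h2.div_const _), integral_const, smul_eq_mul,
    Measure.real]
  congr 1
  simp_rw [div_eq_inv_mul]
  exact integral_const_mul _ _

/-! ## Block volumes -/

/-- **Each block has volume `m⁻³`** (`0 < m`, `k ∈ range m ^ 3`): `repr` is measure preserving onto the unit cube,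
where the block is the box `Π_i [k_i/m, (k_i+1)/m)`. [folklore] -/
theorem volume_block {m : ℕ} (hm : 0 < m) {k : Fin 3 → ℕ}
    (hk : k ∈ Fintype.piFinset fun _ : Fin 3 => Finset.range m) :
    volume {x : T3 | (fun i => ⌊(m : ℝ) * Torus.repr x i⌋₊) = k} = ENNReal.ofReal (((m : ℝ)⁻¹) ^ 3) := by
  have hm0 : (0 : ℝ) < m := Nat.cast_pos.2 hm
  have hk' : ∀ i, k i < m := fun i => Finset.mem_range.1 (Fintype.mem_piFinset.1 hk i)
  -- the box in `ℝ³`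
  set box : Set (EuclideanSpace ℝ (Fin 3)) := {y | ∀ i, y i ∈ Ico ((k i : ℝ) / m) (((k i : ℝ) + 1) / m)}
    with hbox
  have hpre : {x : T3 | (fun i => ⌊(m : ℝ) * Torus.repr x i⌋₊) = k} = Torus.repr ⁻¹' box := by
    ext x
    simp only [mem_setOf_eq, mem_preimage, hbox, mem_Ico, funext_iff]
    refine forall_congr' fun i => ?_
    have hr := Torus.repr_apply_mem_Ico x i
    rw [Nat.floor_eq_iff (mul_nonneg hm0.le hr.1), div_le_iff₀ hm0, lt_div_iff₀ hm0]
    constructor <;> rintro ⟨h1, h2⟩ <;> constructor <;> linarith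
  have hboxm : MeasurableSet box := by
    have : box = ⋂ i, (fun y : EuclideanSpace ℝ (Fin 3) => y i) ⁻¹' Ico ((k i : ℝ) / m) (((k i : ℝ) + 1) / m) := by
      ext y; simp [hbox]
    rw [this]
    exact MeasurableSet.iInter fun i => measurableSet_Ico.preimage (by fun_prop)
  have hsub : box ⊆ Torus.unitCube (Fin 3) := by
    intro y hy i
    have h := hy i
    refine ⟨le_trans (div_nonneg (Nat.cast_nonneg _) hm0.le) h.1, lt_of_lt_of_le h.2 ?_⟩
    rw [div_le_one hm0]
    exact_mod_cast hk' i
  rw [hpre, Torus.measurePreserving_repr.measure_preimage hboxm.nullMeasurableSet,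
    Measure.restrict_apply hboxm, inter_eq_left.2 hsub]
  -- volume of the box via the measurable equivalence with `Fin 3 → ℝ`
  have hbox' : box = (WithLp.ofLp : EuclideanSpace ℝ (Fin 3) → (Fin 3 → ℝ)) ⁻¹'
      (Set.pi univ fun i => Ico ((k i : ℝ) / m) (((k i : ℝ) + 1) / m)) := by
    ext y; simp [hbox]
  rw [hbox', (PiLp.volume_preserving_ofLp (Fin 3)).measure_preimage
      (MeasurableSet.univ_pi fun i => measurableSet_Ico).nullMeasurableSet, volume_pi_pi]
  have hfac : ∀ i : Fin 3, volume (Ico ((k i : ℝ) / m) (((k i : ℝ) + 1) / m)) = ENNReal.ofReal ((m : ℝ)⁻¹) := by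
    intro i
    rw [Real.volume_Ico, add_div, add_sub_cancel_left, one_div]
  simp only [hfac, Finset.prod_const, Finset.card_univ, Fintype.card_fin]
  rw [ENNReal.ofReal_pow (inv_nonneg.2 hm0.le)]

/-- **Integration of a function of the block index**: `∫ g(idx x) dx = Σ_{k ∈ range m ^ 3} m⁻³ g(k)` (`0 < m`).
[folklore] -/
theorem integral_comp_blockIdx {m : ℕ} (hm : 0 < m) (g : (Fin 3 → ℕ) → ℝ) :
    ∫ x : T3, g (fun i => ⌊(m : ℝ) * Torus.repr x i⌋₊) =
      ∑ k ∈ Fintype.piFinset (fun _ : Fin 3 => Finset.range m), ((m : ℝ)⁻¹) ^ 3 * g k := by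
  set K := Fintype.piFinset (fun _ : Fin 3 => Finset.range m) with hK
  set B : (Fin 3 → ℕ) → Set T3 := fun k => {x : T3 | (fun i => ⌊(m : ℝ) * Torus.repr x i⌋₊) = k} with hB
  have hdisj : Set.Pairwise (↑K : Set (Fin 3 → ℕ)) (Function.onFun Disjoint B) := by
    intro k _ k' _ hkk'
    refine Set.disjoint_left.2 fun y hy hy' => hkk' ?_
    simp only [hB, mem_setOf_eq] at hy hy'
    rw [← hy, ← hy']
  have hcover : (volume : Measure T3).restrict (⋃ k ∈ K, B k) = volume := by
    rw [Measure.restrict_eq_self_of_ae_mem]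
    refine ae_of_all _ fun y => ?_
    simp only [mem_iUnion, exists_prop]
    exact ⟨_, blockIdx_mem_piFinset hm y, by simp [hB]⟩
  have hgm : Integrable (fun x : T3 => g (fun i => ⌊(m : ℝ) * Torus.repr x i⌋₊)) volume := by
    have hmeas : Measurable fun x : T3 => g (fun i => ⌊(m : ℝ) * Torus.repr x i⌋₊) := by
      have hfin : ∀ x : T3, (fun i => ⌊(m : ℝ) * Torus.repr x i⌋₊) ∈ (K : Set (Fin 3 → ℕ)) :=
        fun x => blockIdx_mem_piFinset hm x
      refine Measurable.comp (g := g) (f := fun x : T3 => fun i => ⌊(m : ℝ) * Torus.repr x i⌋₊) ?_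
        (measurable_blockIdx m)
      exact measurable_of_countable g
    obtain ⟨C, hC⟩ : ∃ C, ∀ k ∈ K, |g k| ≤ C :=
      ⟨K.sup' ⟨_, blockIdx_mem_piFinset hm 0⟩ fun k => |g k|, fun k hk => Finset.le_sup' (fun k => |g k|) hk⟩
    refine (integrable_const C).mono' hmeas.aestronglyMeasurable (ae_of_all _ fun x => ?_)
    rw [Real.norm_eq_abs]
    exact hC _ (blockIdx_mem_piFinset hm x)
  conv_lhs => rw [← hcover]
  rw [integral_biUnion_finset K (fun k _ => measurableSet_block m k) hdisj fun k _ => hgm.integrableOn]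
  refine Finset.sum_congr rfl fun k hk => ?_
  have hconst : ∀ᵐ x ∂(volume : Measure T3).restrict (B k),
      g (fun i => ⌊(m : ℝ) * Torus.repr x i⌋₊) = g k := by
    filter_upwards [ae_restrict_mem (measurableSet_block m k)] with x hx
    simp only [hB, mem_setOf_eq] at hx
    rw [hx]
  rw [integral_congr_ae hconst, integral_const, smul_eq_mul, Measure.real, Measure.restrict_apply_univ,
    volume_block hm hk, ENNReal.toReal_ofReal (pow_nonneg (inv_nonneg.2 (Nat.cast_nonneg m)) 3)]

end Summit.AtomisticToContinuum.HydrodynamicLimit.Theorems.JaynesSqueezeSqueeze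

end
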